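import Literature.NumberTheory.EllipticCurves.Kato2004.UniversalNormsCoeffFramed
import HarnessLib

/-!
# `H¹(U, T_ρ) → lim←_k H¹(U, A_ρ[p^k])` is INJECTIVE: a class of `H¹(U, T_ρ)` is determined by its
# reductions `red_{p^k}` (`GreenbergSelmer.reduceH1CofreePkTorsion`) — Rubin B.2.3 / Kato §8.2, `T_ρ = 𝒪ⁿ`

Topic `NumberTheory/EllipticCurves`, namespace `Literature.NumberTheory.EllipticCurves.GreenbergSelmer`
(where `reduceH1CofreePkTorsion` lives).  THEOREMS ONLY (no definition, no named fact, no instance, no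
`sorry`).  Written by a prover seat of the cell `bsd-wall` (route `ResidualThetaTransportAtTwo`, crux RSL_g
stmt-BirchSwinnertonDyer-22608; stub-plan rev 14 Q59, card `stub-cmlambdalower-k3-g10` item H-D
`CofreeReductionSeparated`): for a framed representation `ρ : Γ_ℚ → GL_n(𝒪)` with
`𝒪 = padicCoeffIntegers S` COMPACT (e.g. `ℚ_p(S)/ℚ_p` finite, `UniversalNorms.compactSpace_padicCoeffIntegers`)
and any `U ≤ Γ_ℚ`,

* `eq_zero_of_forall_reduceH1CofreePkTorsion_eq_zero` — `red_{p^k} x = 0` for all `k` ⇒ `x = 0`: by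
  `UniversalNorms.reduceH1CofreePkTorsion_eq_zero_iff` (`ker red_{p^k} = p^k · H¹`, Kato §13.8 levelwise) the
  class is divisible by every `p^k`, and `⋂_k p^k H¹(U, T_ρ) = 0`
  (`UniversalNorms.eq_zero_of_forall_exists_pow_smul_eq_of_compactSpace`, compactness of `𝒪ⁿ`);
* `eq_of_forall_reduceH1CofreePkTorsion_eq` — **two classes with the same reductions modulo every `p^k`
  are equal** (the injectivity half of `H¹(U, T) = lim←_k H¹(U, T/p^k)` for `T = T_ρ`, `T/p^k ≅ A_ρ[p^k]`:
  Rubin, *Euler Systems*, Prop. B.2.3; Kato §8.2 "`H^q(R, T) = lim←_n H^q(R, T/p^n)`" p. 180), the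
  `ρ`-coefficient twin of the tree's `Kato2004.eq_of_forall_reduceH1Pk_eq` (`T_pW → W[p^k]`); and the
  `[FiniteDimensional ℚ_[p] (padicCoeffField S)]` forms.

This discharges the signature H-D `CofreeReductionSeparated S ρ U` of the card k3-g10 (the SEP input of
its Kőnig glue `exists_limitFamily_of_levelwise`).  HONEST FRAMING: a port of a standard fact; nothing
here is specific to BSD; BSD is not proved by any of this.

References: K. Rubin, *Euler Systems* (2000), App. B Prop. B.2.3 [Rubin2000]; K. Kato, Astérisque 295
(2004), §8.2 (p. 180), §13.8 (pp. 228–229) [Kato2004Asterisque]; R. Greenberg, Adv. Stud. Pure Math. 17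
(1989), §1 p. 98 [Greenberg1989].
-/

noncomputable section

open Field
open Literature.NumberTheory.GaloisRepresentations
open Literature.NumberTheory.EllipticCurves
open Literature.NumberTheory.EllipticCurves.Kato2004

namespace Literature.NumberTheory.EllipticCurves.GreenbergSelmer

variable {p : ℕ} [Fact p.Prime] (S : Set (PadicAlgCl p)) {n : ℕ}
  (ρ : FramedGaloisRep ℚ (padicCoeffIntegers S) n) (U : Subgroup (absoluteGaloisGroup ℚ))

/-- **`⋂_k ker red_{p^k} = 0` on `H¹(U, T_ρ)`** (`𝒪` compact): a class whose reductions
`reduceH1CofreePkTorsion S ρ k U x ∈ H¹(U, A_ρ[p^k])` vanish for every `k` is zero — it is divisible by every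
`p^k` (`UniversalNorms.reduceH1CofreePkTorsion_eq_zero_iff`) and `⋂_k p^k H¹(U, T_ρ) = 0`
(`UniversalNorms.eq_zero_of_forall_exists_pow_smul_eq_of_compactSpace`).
[cite: Rubin2000, App. B Prop. B.2.3] [cite: Kato2004Asterisque, §8.2 (p. 180) and §13.8 (p. 228)] -/
theorem eq_zero_of_forall_reduceH1CofreePkTorsion_eq_zero [CompactSpace (padicCoeffIntegers S)]
    (x : H1 (FramedGaloisRep.toGaloisRep ρ) U) (hx : ∀ k, reduceH1CofreePkTorsion S ρ k U x = 0) :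
    x = 0 :=
  UniversalNorms.eq_zero_of_forall_exists_pow_smul_eq_of_compactSpace (FramedGaloisRep.toGaloisRep ρ) p
    (UniversalNorms.tendsto_pow_smul_pi_padicCoeffIntegers S) U x fun k =>
    (UniversalNorms.reduceH1CofreePkTorsion_eq_zero_iff S ρ k U x).mp (hx k)

/-- **`H¹(U, T_ρ) → lim←_k H¹(U, A_ρ[p^k])` is injective** (`𝒪` compact): two classes of `H¹(U, T_ρ)` with
the same reduction in `H¹(U, A_ρ[p^k])` for every `k` are equal (Rubin B.2.3, injectivity half, for
`T = T_ρ` and the tower `T/p^k ≅ A_ρ[p^k]`; `ρ`-twin of `Kato2004.eq_of_forall_reduceH1Pk_eq`).  Discharges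
the signature `CofreeReductionSeparated S ρ U` of the crux-card k3-g10 (route `ResidualThetaTransportAtTwo`,
stmt-BirchSwinnertonDyer-22608). [cite: Rubin2000, App. B Prop. B.2.3] [cite: Kato2004Asterisque, §8.2 (p. 180)] -/
theorem eq_of_forall_reduceH1CofreePkTorsion_eq [CompactSpace (padicCoeffIntegers S)]
    (x y : H1 (FramedGaloisRep.toGaloisRep ρ) U)
    (h : ∀ k, reduceH1CofreePkTorsion S ρ k U x = reduceH1CofreePkTorsion S ρ k U y) : x = y :=
  sub_eq_zero.mp (eq_zero_of_forall_reduceH1CofreePkTorsion_eq_zero S ρ U (x - y) fun k => by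
    rw [map_sub, h k, sub_self])

/-- `⋂_k ker red_{p^k} = 0` on `H¹(U, T_ρ)` for `𝒪` the valuation ring of a FINITE extension `ℚ_p(S)/ℚ_p`.
[cite: Rubin2000, App. B Prop. B.2.3] -/
theorem eq_zero_of_forall_reduceH1CofreePkTorsion_eq_zero_of_finiteDimensional
    [FiniteDimensional ℚ_[p] (padicCoeffField S)]
    (x : H1 (FramedGaloisRep.toGaloisRep ρ) U) (hx : ∀ k, reduceH1CofreePkTorsion S ρ k U x = 0) :
    x = 0 := by
  haveI := UniversalNorms.compactSpace_padicCoeffIntegers S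
  exact eq_zero_of_forall_reduceH1CofreePkTorsion_eq_zero S ρ U x hx

/-- **Injectivity of `H¹(U, T_ρ) → lim←_k H¹(U, A_ρ[p^k])`** for `𝒪` the valuation ring of a FINITE
extension `ℚ_p(S)/ℚ_p` — the form consumed by the crux RSL_g (`[FiniteDimensional ℚ_[p] (padicCoeffField S)]`
is its standing instance). [cite: Rubin2000, App. B Prop. B.2.3] [cite: Kato2004Asterisque, §8.2 (p. 180)] -/
theorem eq_of_forall_reduceH1CofreePkTorsion_eq_of_finiteDimensional
    [FiniteDimensional ℚ_[p] (padicCoeffField S)]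
    (x y : H1 (FramedGaloisRep.toGaloisRep ρ) U)
    (h : ∀ k, reduceH1CofreePkTorsion S ρ k U x = reduceH1CofreePkTorsion S ρ k U y) : x = y := by
  haveI := UniversalNorms.compactSpace_padicCoeffIntegers S
  exact eq_of_forall_reduceH1CofreePkTorsion_eq S ρ U x y h

end Literature.NumberTheory.EllipticCurves.GreenbergSelmer

end
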